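import Literature.Barriers.NavierStokesRegularity.NavierStokesInequalityProfilesQ
import Literature.Barriers.NavierStokesRegularity.NavierStokesInequalityProfileBlock
import HarnessLib

/-!
# Fact D-II discharged: every geometric arrangement carries profile data

Barrier catalogue support file for `NavierStokesRegularity` (D-0021): the DISCHARGE of fact D-II
`Literature.Barriers.NavierStokesRegularity.NSIProfiles_of_arrangement` of
`NavierStokesInequalityProfiles` — V. Scheffer, *A solution to the Navier–Stokes inequality with
an internal singularity*, Comm. Math. Phys. 101 (1985), **Lemmas 3.1–3.2** (pp. 57–66: the
cut-offs and the profiles `h₁, h₂, δ` of Lemma 3.1, (3.8)–(3.15); the switching scheme of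
Lemma 3.2, (3.34)–(3.41), with the uniform-continuity choice (3.56) of the period), in the
smooth-direction presentation of W. S. Ożański, arXiv:1709.00602v4, **§4.1** (Lemma 4.1, the
profiles `qᵏ_{i,t}` of (4.16) driven by the oscillatory processes `aᵢᵏ` of **Theorem 4.3**,
(4.17)–(4.20)) and **§4.2** (Cases 1–2 with (4.27), through the first lemma of Appendix A.3).

The proof is assembled from the tree's PROVED ingredients:

* Lemma 4.1 — `IsNSIArrangement.exists_hProfileData` (`NavierStokesInequalityProfilesH`, on
  the damped profiles of `NavierStokesInequalityDampedProfile` and the perturbation criterion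
  of `NavierStokesInequalityProfilePerturbation`);
* Theorem 4.3 — `Scheffer.exists_oscillatoryProcesses` (`NavierStokesInequalityOscillatoryProcesses`),
  with (4.18)/(4.22) up to two derivatives, `IsOscFamily.oscError_small_two`
  (`NavierStokesInequalityProfileConvergence`);
* Appendix A.3, first lemma — `exists_planePressure_sub_le` (`NavierStokesInequalityPressureContinuity`);
* the construction (4.16) and the verification of §4.2 — `IsQData.exists_profileData`,
  `IsNSIArrangement.exists_profileData` (`NavierStokesInequalityProfilesQ`).

With fact D-I (`NSIBlock_of_profiles_holds`, `NavierStokesInequalityProfileBlock`) this closes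
fact D `NSIBlock_of_arrangement` through `nsiBlock_of_arrangement_of_profiles`.

## References

* V. Scheffer, Comm. Math. Phys. 101 (1985), 47–85: Lemmas 3.1–3.3, (3.8)–(3.41), (3.56)–(3.58).
  [`Scheffer1985`]
* W. S. Ożański, arXiv:1709.00602v4, §4.1 (Lemma 4.1, (4.16)–(4.20)), §4.2, §4.3 (Theorem 4.3),
  Appendix A.3. [`Ozanski2017NSISingular`] (Held plain-text rendering: Lemma 8, Prop. 9, Thm. 10.)
-/

noncomputable section

namespace Literature.Barriers.NavierStokesRegularity

/-- **Fact D-II holds: every geometric arrangement carries profile data** (Scheffer 1985,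
Lemmas 3.1–3.2; Ożański 2017, Lemma 4.1, §4.1 with Theorem 4.3 and Appendix A.3).
[cite: Scheffer1985, Lemmas 3.1–3.2] [cite: Ozanski2017NSISingular, Lemma 4.1, §4.1 and Theorem 4.3] -/
theorem NSIProfiles_of_arrangement_holds : NSIProfiles_of_arrangement :=
  fun _ _ _ _ _ _ _ _ _ _ _ hA => hA.exists_profileData

/-- **Fact D `NSIBlock_of_arrangement` holds**, from D-I (`NSIBlock_of_profiles_holds`, the tree's
`NavierStokesInequalityProfileBlock`) and D-II, through `nsiBlock_of_arrangement_of_profiles`.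
[cite: Scheffer1985, Lemma 3.3] [cite: Ozanski2017NSISingular, §4 (Prop. 4.2)] -/
theorem NSIBlock_of_arrangement_holds : NSIBlock_of_arrangement :=
  nsiBlock_of_arrangement_of_profiles NSIBlock_of_profiles_holds NSIProfiles_of_arrangement_holds

end Literature.Barriers.NavierStokesRegularity
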